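import Literature.MathematicalPhysics.QuantumFieldTheory.Balaban1983to89.B15Prop1CarrierOnFromModel
import Literature.MathematicalPhysics.QuantumFieldTheory.Balaban1983to89.B15Prop1GaugeFixing

/-!
# `Balaban1983to89.B15Prop1CarrierOnFromLetters` — T. Bałaban, *Large field renormalization. I. The basic step of the 𝐑 operation*,
Commun. Math. Phys. **122** (1989) 175–202 [Balaban1989LargeFieldI] («[IV]»), **Proposition 1** p. 194, proof [Balaban1989LargeFieldII]
(«[LF-II]») pp. 358–359: **`B15.Prop1Printed` AT THE CARRIER OF RECORD `lfVarOn ch I` WITH THE GAUGE-FIXING DICTIONARY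
DERIVED** — the dictionary items (c1) *«V′ satisfies mild regularity conditions»*, (c2) *«Fixing the gauge G₀ for V′ we get a
small configuration, and we can write V′ = exp iB′»* and (c4) (the (1.78) deviation of the chart point) of
`B15Prop1CarrierOnFromModel.prop1Printed_lfVarOn_of_model_sol` (v1.1, p-this-lineage) are no longer hypotheses: they are SUPPLIED
from the located OBJECT LETTERS — the `G₀`-representative and its smallness ((G)+(L): `B15Prop1GaugeFixing` §1–§3 for any rooted
tree; `B15Prop1RelativeAxialGauge.exists_isGaugeOn_relSmall` (lit-balaban-type-B15, p465628) for print's `x₁`-axial `G₀` on a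
box), the chart letters (X)/(ℓ1) (theorems at `G = SU(2)`: `B15Prop1ChartSU2`, p465147), the extension letters (ℓ2) ([IV] p. 193,
`B15Extension193`), and three COORDINATE facts tying the model's gauge-fixed Hilbert space `E i` (*«the subspace of B′ satisfying
the gauge condition B′↾_{G₀} = 0»*, p. 359) to the bond fields supported off `G₀`.

statement-level skeleton of published theorems with citation tags; proofs where landed; nothing here is a claim about
the Yang–Mills mass gap

Cell pub-ymgap, HUMAN RULING D-0062 (Track A full width), seat `pub-ymgap-dag-n12-c` (R134 acceleration seat (a), strategy s1
of DAG node N12 = [B15]; generation g2, fourth product).  PDFs held: `paper:balaban1989-cmp122-large-field-i` (journal page =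
PDF page + 174), `paper:balaban1989-cmp122-large-field-ii` (journal page = PDF page + 354; pp. 357–359 = PDF 3–5).

THE PRINT ([LF-II] p. 359, verbatim): *«We fix such an extension, and we consider the variational problem for the function
V′↾_Λ → A(U_{k,Z}(V′V_k)), where V′ satisfies mild regularity conditions. Fixing the gauge G₀ for V′ we get a small
configuration, and we can write V′ = exp iB′. We expand the function with respect to B′ … Now the condition for a critical
configuration is the equation (1.12) … Denote by P₀ the projection onto the subspace of B′ satisfying the gauge condition
B′↾_{G₀} = 0. … Using Proposition 4 [15] and the fixed point theorem for contractive mappings, we can easily prove that the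
above equation has exactly one solution, which has a bound equal to twice a bound of the right-hand side of the equation …
This proves the existence and the uniqueness statements of Proposition 1 [IV], and the bound (1.78) [IV].»*

WHAT THIS FILE PROVES (theorems only; Mathlib + the two imports; no `sorry`, no definition, no `… : Prop` fact; axioms standard).
§1 `exists_rep_of_loops` — (G)+(L) ⇒ THE `G₀`-REPRESENTATIVE in the form the assembly reads (`u` defined on `S`, `V^u = Ṽ` on
   `T ∪ (bondsOf S)ᶜ`, `|V^u(b)Ṽ(b)⁻¹ − 1| < δc` on `bondsOf S ∖ T`), from `B15Prop1GaugeFixing.exists_isGaugeOn_agree` and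
   `dist1_gaugeAct_ratio_le` BY NAME; `rep_of_bounds` — the same form from a representative given with a uniform bound on all
   bonds meeting `S` (the output of `B15Prop1RelativeAxialGauge.exists_isGaugeOn_relSmall`).
§2 **`prop1Printed_lfVarOn_of_letters`** — `B15.Prop1Printed (lfVarOn ch I)` for instances with print's example domain
   `dom = domReg Z k a₁` and THE PRINTED CHART `φ i V_k B := expMul ch (ιA i B) (ext i V_k)` (`exp(iB′)·Ṽ_k`), from: the model
   letters (m1)–(m5), (x) exactly as in `prop1Printed_lfVarOn_of_model_sol`; (c3) `IsCriticalPt ↔ (1.12)` at chart points,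
   (c3′) criticality along Λ-orbits, (c3″) Λ-invariance of `f`; THE REPRESENTATIVE (hrep: (G)+(L), per regular datum and value of
   the variables in the domain); THE EXTENSION (hext0: `ext V_k ∈ extSet V_k`; (ℓ2) `|∂Ṽ_k − 1| ≤ b_x M²ε` on the plaquettes
   inside `Z^{(k)}` and on those meeting `Λ^{(k)}`); THE CHART ((X) `exp i∘(1/i)log = id` and `‖(1/i) log g‖ ≤ C_ℓ|g − 1|` below
   `δc`; (ℓ1) `|exp(iX) − 1| ≤ κ‖X‖`); THE COORDINATES ((ι1) `ιA B` is supported on `bondsOf S ∖ T` for `B` in the range of `P₀`;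
   (ι2) every such bond field with values of norm `≤ t` is `ιA B` for some `B = P₀B` with `‖B‖ ≤ N·t`; (ι3) `‖ιA B (b)‖ ≤ ‖B‖`);
   THE THRESHOLDS `N·C_ℓ·δc ≤ r` (the chart image of the domain lies in the Proposition-4 ball) and
   `(4κ·2M⁵hst·cJ/γ + b_x M²)·ε < a₁` for `ε ≤ eD` (the solution's orbit lies in the domain).  DERIVED inside: (c1) at the
   solution scale (`B15Prop1GaugeFixing.orbit_expMul_subset`), (c2) (`B15Prop1GaugeFixing.exists_vecField_expMul_eq` + (ι2)),
   (c4) (`B15Prop1ChartDeviation.dist1_plaqHol_expMul_le_of_forall` + (ℓ2)); constants `a = 4κ`, `b = b_x`, so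
   `B₅ = 8κ·hst·cJ/γ + b_x + 1`.

HONEST SCOPE.  (i) What stays displayed is exactly: the p. 359 expansion letters (m1)–(m5) with (c3) (the expansion pieces
`H_{1,k}`, `H*_{1,k}`, `Δ₁`, `(δ/δA)V`, `J_{k,Z}` OF RECORD and the identification of the first variation with (1.12) — NODE 00's
objects), (c3′)/(c3″) (at `SU(2)` (c3′) follows from (c3″) by `B15Prop1ChartSU2.isCriticalPt_gaugeAct_su2`; (c3″) at print's instance
is `B15Prop1Carrier.std_f_gaugeAct` over the (181) covariance), the analytic-extension clause (x), the representative (hrep —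
a theorem for print's `x₁`-axial `G₀` on a box: `B15Prop1RelativeAxialGauge`, and for any rooted tree modulo the loop letter:
§1), the extension letters (for a box: `B15Extension193.extension_box`, with the corner-plaquette reading note G-B15-02 there),
the chart letters (theorems at `SU(2)`), the coordinate facts (finite-dimensional bookkeeping of the pin's choice of `E i`), and
the two thresholds (print: *«for ε > 0 sufficiently small»*, `a₁` of the *«mild regularity conditions»* small with `M`).  (ii)
`dom = domReg` (print's example domain); other domains need their own (c1).  (iii) Count-neutral; NOT a discharge of N12 (the
pin `ResidW.LF := lfVarOn ch I` and the expansion pieces of record are NODE 00's); NOT summit progress.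
-/

noncomputable section

open Set
open scoped RealInnerProductSpace

namespace Literature.MathematicalPhysics.QuantumFieldTheory.Balaban1983to89.B15Prop1CarrierOnFromLetters

open B15DeterminingSets GaugeField B16Sect1Backgrounds B15Prop1Carrier B8Eq17ClassAkV1
open B15Prop1GaugeFixing B15Prop1CarrierOnFromModel

variable {P : Params}

/-! ## §1 The `G₀`-representative in the form the assembly reads -/

section Representative

variable {j : ℕ} {G : Type*} [GaugeGroup G]

/-- **(G)+(L) ⇒ the `G₀`-representative**, packaged: from a fresh-endpoint order on `T` with fresh ends in `S`, the chain letter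
(L) and `V ∈ extSet (bondsOf S) Ṽ`, a transformation `u` defined on `S` with `V^u = Ṽ` on `T ∪ (bondsOf S)ᶜ` and
`|V^u(b)Ṽ(b)⁻¹ − 1| < δc` on `bondsOf S ∖ T` (`B15Prop1GaugeFixing` §2–§3 by name). [cite: Balaban1989LargeFieldII, p.359] -/
theorem exists_rep_of_loops [DecidableEq (PBond P j)] {T : Finset (PBond P j)} {v : PBond P j → Site P j}
    {r : Site P j → ℕ} (hT : T4AxialGaugeFixing.TreeOrder T v r) {S : Set (Site P j)} (hv : ∀ b ∈ T, v b ∈ S)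
    {Vt V : GaugeField P j G} (hV : V ∈ extSet (bondsOf S) Vt) {δc : ℝ}
    (hloop : ∀ b, b ∈ bondsOf S → b ∉ T →
      ∃ (s : ℕ → Site P j) (c : ℕ → PBond P j) (n m₀ : ℕ), m₀ < n ∧ c m₀ = b ∧
        (∀ m < n, T4TreeGaugeFixing.Joins (c m) (s m) (s (m + 1))) ∧ s 0 ∉ S ∧ s n ∉ S ∧
        (∀ m < n, m ≠ m₀ → c m ∈ T ∨ c m ∉ bondsOf S) ∧
        dist1 (T4TreeGaugeTransform.chainHol s c V n) + dist1 (T4TreeGaugeTransform.chainHol s c Vt n) < δc) :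
    ∃ u : GaugeTransf P j G, IsGaugeOn S u ∧ (∀ b, (b ∈ T ∨ b ∉ bondsOf S) → gaugeAct u V b = Vt b) ∧
      ∀ b, b ∈ bondsOf S → b ∉ T → dist1 (gaugeAct u V b * (Vt b)⁻¹) < δc := by
  obtain ⟨u, hu, hagree⟩ := exists_isGaugeOn_agree hT hv hV
  refine ⟨u, hu, hagree, fun b hbS hbT => ?_⟩
  obtain ⟨s, c, n, m₀, hm₀, hb, hjoins, hs0, hsn, hrest, hδ⟩ := hloop b hbS hbT
  exact (dist1_gaugeAct_ratio_le s c hjoins (hu _ hs0) (hu _ hsn) hm₀ hb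
    fun m hm hne => hagree _ (hrest m hm hne)).trans_lt hδ

/-- **The representative from a uniform bound** (adapter for `B15Prop1RelativeAxialGauge.exists_isGaugeOn_relSmall`, print's
`x₁`-axial `G₀` on a box): if `V^u = Ṽ` off the bonds meeting `S` and on a bond set `T`, and `|V^u(b)Ṽ(b)⁻¹ − 1| ≤ δ < δc` on every
bond meeting `S`, then the representative has the form the assembly reads. [cite: Balaban1989LargeFieldII, pp.358–359] -/
theorem rep_of_bounds {S : Set (Site P j)} {T : Finset (PBond P j)} {u : GaugeTransf P j G} {V Vt : GaugeField P j G}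
    (hoff : ∀ b, b ∉ bondsOf S → gaugeAct u V b = Vt b) (hT : ∀ b ∈ T, gaugeAct u V b = Vt b) {δ δc : ℝ}
    (hbound : ∀ b ∈ bondsOf S, dist1 (gaugeAct u V b * (Vt b)⁻¹) ≤ δ) (hδ : δ < δc) :
    (∀ b, (b ∈ T ∨ b ∉ bondsOf S) → gaugeAct u V b = Vt b) ∧
      ∀ b, b ∈ bondsOf S → b ∉ T → dist1 (gaugeAct u V b * (Vt b)⁻¹) < δc :=
  ⟨fun b hb => hb.elim (hT b) (hoff b), fun b hbS _ => (hbound b hbS).trans_lt hδ⟩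

end Representative

/-! ## §2 Proposition 1 at the carrier of record from the object letters -/

section Assembly

variable {G : Type} [GaugeGroup G] {𝔥 : Type*} [NormedAddCommGroup 𝔥] [NormedSpace ℝ 𝔥]

/-- **PROPOSITION 1 [IV] AT THE CARRIER OF RECORD `lfVarOn ch I`, THE GAUGE-FIXING DICTIONARY DERIVED.**  Instances with print's
example domain `dom = domReg Z k a₁`; the chart IS the printed one, `φ i V_k B = exp(i·ιA B)·Ṽ_k(V_k)` with `Ṽ_k = ext i V_k` the
fixed extension and `ιA` the coordinates of the gauge-fixed space `E i`.  Hypotheses: the p. 359 model letters (m1) positivity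
(1.9) on the range of `P₀`, (m2) `P₀` idempotent symmetric, `H*` adjoint to `H`, `‖H‖ ≤ h₁`, `‖H*‖ ≤ hst`, (m3) Proposition 4 [15]
Lipschitz data and the contraction smallness, (m4) `‖J‖ ≤ cJ·ε` on regular data, (m5) the first variation of `B′ ↦ f(φ B′)`,
(x) the analytic-extension clause; (c3) `IsCriticalPt ⇔ (1.12)` at chart points of the ball, (c3′) criticality passes along
Λ-orbits, (c3″) `f` is Λ-invariant; the `G₀`-REPRESENTATIVE with its smallness (hrep); the extension letters (hext0, hextZ,
hextΛ); the chart letters (hlog, hlip, hexp); the coordinate facts (hι1, hι2, hι3); the thresholds (hN, he1).  CONCLUSION: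
`B15.Prop1Printed (lfVarOn ch I)` with `B₅ = 8κ·hst·cJ/γ + b_x + 1`.  BY NAME: `prop1Printed_lfVarOn_of_model_sol` with (c1) ⇐
`B15Prop1GaugeFixing.orbit_expMul_subset`, (c2) ⇐ `B15Prop1GaugeFixing.exists_vecField_expMul_eq`, (c4) ⇐
`B15Prop1ChartDeviation.dist1_plaqHol_expMul_le_of_forall`. [cite: Balaban1989LargeFieldI, Prop. 1 (1.77)–(1.78) p.194;
Balaban1989LargeFieldII, pp.358–359 (proof of Proposition 1 [IV]), (1.9), (1.12)–(1.13); Balaban1985Variational, Prop. 4 p.293] -/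

theorem prop1Printed_lfVarOn_of_letters (ch : ExpChart G 𝔥) {ι : Type} (I : ι → InstOn P G)
    [∀ i, DecidableEq (PBond P (I i).k)]
    {E F : ι → Type*}
    [∀ i, NormedAddCommGroup (E i)] [∀ i, InnerProductSpace ℝ (E i)] [∀ i, FiniteDimensional ℝ (E i)]
    [∀ i, NormedAddCommGroup (F i)] [∀ i, InnerProductSpace ℝ (F i)]
    (P₀ : ∀ i, E i →ₗ[ℝ] E i) (hP2 : ∀ i x, P₀ i (P₀ i x) = P₀ i x) (hPsa : ∀ i (x y : E i), ⟪P₀ i x, y⟫ = ⟪x, P₀ i y⟫)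
    (H : ∀ i, GaugeField P (I i).k G → (E i →ₗ[ℝ] F i)) (Hst : ∀ i, GaugeField P (I i).k G → (F i →ₗ[ℝ] E i))
    (hadj : ∀ i Vk (x : E i) (y : F i), ⟪H i Vk x, y⟫ = ⟪x, Hst i Vk y⟫)
    (Δ₁ : ∀ i, GaugeField P (I i).k G → (F i →ₗ[ℝ] F i)) (dV : ∀ i, GaugeField P (I i).k G → F i → F i)
    (J : ∀ i, GaugeField P (I i).k G → F i)
    (T : ∀ i, Finset (PBond P (I i).k))
    (ext : ∀ i, GaugeField P (I i).k G → GaugeField P (I i).k G)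
    (ιA : ∀ i, E i →ₗ[ℝ] VecField P (I i).k 𝔥)
    {γ h₁ hst cJ bx κ Cℓ : ℝ} (hγ : 0 < γ) (hh₁ : 0 ≤ h₁) (hhst : 0 ≤ hst) (hcJ : 0 ≤ cJ) (hbx : 0 ≤ bx) (hκ : 0 ≤ κ)
    (hCℓ : 0 ≤ Cℓ)
    {ℓ ρ r eA eD a₁ δc N : ι → ℝ} (hℓ : ∀ i, 0 ≤ ℓ i) (hr : ∀ i, 0 < r i) (heA : ∀ i, 0 < eA i) (heD : ∀ i, 0 < eD i)
    (hδc : ∀ i, 0 < δc i) (hM : ∀ i, 1 ≤ (I i).M)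
    (hpos : ∀ i Vk x, P₀ i x = x → γ / (I i).M ^ 5 * ‖x‖ ^ 2 ≤ ⟪H i Vk x, Δ₁ i Vk (H i Vk x)⟫)
    (hH : ∀ i Vk x, ‖H i Vk x‖ ≤ h₁ * ‖x‖) (hHst : ∀ i Vk z, ‖Hst i Vk z‖ ≤ hst * ‖z‖)
    (hdV0 : ∀ i Vk, dV i Vk 0 = 0)
    (hdV : ∀ i Vk (u v : F i), ‖u‖ ≤ ρ i → ‖v‖ ≤ ρ i → ‖dV i Vk u - dV i Vk v‖ ≤ ℓ i * ‖u - v‖)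
    (hρ : ∀ i, h₁ * r i ≤ ρ i) (hsmall : ∀ i, (I i).M ^ 5 / γ * hst * ℓ i * h₁ ≤ 1 / 2)
    (hA : ∀ i Vk (X δ : E i), HasDerivAt (fun s : ℝ => (I i).f (expMul ch (ιA i (X + s • δ)) (ext i Vk)))
      (⟪δ, Hst i Vk (J i Vk)⟫ + ⟪δ, Hst i Vk (Δ₁ i Vk (H i Vk X))⟫ + ⟪δ, Hst i Vk (dV i Vk (H i Vk X))⟫) 0)
    (hJ : ∀ i ε Vk, 0 < ε → (lfVarOn ch I).Regular i ε Vk → ‖J i Vk‖ ≤ cJ * ε)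
    (hc3 : ∀ i Vk (B : E i), P₀ i B = B → ‖B‖ ≤ r i →
      (IsCriticalPt ch (bondsOf (pts (I i).k (I i).Λ)) (I i).f (expMul ch (ιA i B) (ext i Vk)) ↔
        ∀ δB : E i, P₀ i δB = δB →
          ⟪δB, Hst i Vk (J i Vk)⟫ + ⟪δB, Hst i Vk (Δ₁ i Vk (H i Vk B))⟫ + ⟪δB, Hst i Vk (dV i Vk (H i Vk B))⟫ = 0))
    (hc3' : ∀ i (u : GaugeTransf P (I i).k G) (V : GaugeField P (I i).k G), IsGaugeOn (pts (I i).k (I i).Λ) u →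
      IsCriticalPt ch (bondsOf (pts (I i).k (I i).Λ)) (I i).f V →
        IsCriticalPt ch (bondsOf (pts (I i).k (I i).Λ)) (I i).f (gaugeAct u V))
    (hc3'' : ∀ i (u : GaugeTransf P (I i).k G) (V : GaugeField P (I i).k G), IsGaugeOn (pts (I i).k (I i).Λ) u →
      (I i).f (gaugeAct u V) = (I i).f V)
    (hAn : ∀ i ε Vk, 0 < ε → ε ≤ eA i → (lfVarOn ch I).Regular i ε Vk → (I i).An ε Vk)
    -- the domain: print's example
    (hdom : ∀ i, (I i).dom = domReg (I i).Z (I i).k (a₁ i))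
    -- the extension letters (ℓ2)
    (hext0 : ∀ i Vk, ext i Vk ∈ extSet (bondsOf (pts (I i).k (I i).Λ)) Vk)
    (hextZ : ∀ i ε Vk, 0 < ε → ε ≤ eD i → (lfVarOn ch I).Regular i ε Vk →
      ∀ p ∈ plaqsInside (pts (I i).k (I i).Z), dist1 (plaqHol (ext i Vk) p) ≤ bx * (I i).M ^ 2 * ε)
    (hextΛ : ∀ i ε Vk, 0 < ε → (lfVarOn ch I).Regular i ε Vk →
      ∀ p ∈ plaqsOf (pts (I i).k (I i).Λ), dist1 (plaqHol (ext i Vk) p) ≤ bx * (I i).M ^ 2 * ε)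
    -- the chart letters (X), (ℓ1)
    (hlog : ∀ i (g : G), dist1 g < δc i → ch.iexp (ch.ilog g) = g)
    (hlip : ∀ i (g : G), dist1 g < δc i → ‖ch.ilog g‖ ≤ Cℓ * dist1 g)
    (hexp : ∀ X : 𝔥, dist1 (ch.iexp X) ≤ κ * ‖X‖)
    -- the coordinates
    (hι1 : ∀ i (B : E i), P₀ i B = B → IsSupportedOn {b | b ∈ bondsOf (pts (I i).k (I i).Λ) ∧ b ∉ T i} (ιA i B))
    (hι2 : ∀ i (A : VecField P (I i).k 𝔥) (t : ℝ), IsSupportedOn {b | b ∈ bondsOf (pts (I i).k (I i).Λ) ∧ b ∉ T i} A →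
      (∀ b, ‖A b‖ ≤ t) → ∃ B : E i, P₀ i B = B ∧ ιA i B = A ∧ ‖B‖ ≤ N i * t)
    (hι3 : ∀ i (B : E i) (b : PBond P (I i).k), ‖ιA i B b‖ ≤ ‖B‖)
    -- the gauge (G)+(L): the `G₀`-representative and its smallness
    (hrep : ∀ i ε Vk (V : GaugeField P (I i).k G), 0 < ε → ε ≤ eD i → (lfVarOn ch I).Regular i ε Vk →
      V ∈ extSet (bondsOf (pts (I i).k (I i).Λ)) Vk ∩ (I i).dom →
        ∃ u : GaugeTransf P (I i).k G, IsGaugeOn (pts (I i).k (I i).Λ) u ∧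
          (∀ b, (b ∈ T i ∨ b ∉ bondsOf (pts (I i).k (I i).Λ)) → gaugeAct u V b = ext i Vk b) ∧
          ∀ b, b ∈ bondsOf (pts (I i).k (I i).Λ) → b ∉ T i → dist1 (gaugeAct u V b * (ext i Vk b)⁻¹) < δc i)
    -- thresholds
    (hN : ∀ i, N i * (Cℓ * δc i) ≤ r i)
    (he1 : ∀ i ε, 0 < ε → ε ≤ eD i → (4 * κ * (2 * (I i).M ^ 5 * hst * cJ / γ) + bx * (I i).M ^ 2) * ε < a₁ i) :
    B15.Prop1Printed (lfVarOn ch I) := by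
  refine prop1Printed_lfVarOn_of_model_sol ch I P₀ hP2 hPsa H Hst hadj Δ₁ dV J
    (fun i Vk B => expMul ch (ιA i B) (ext i Vk)) hγ hh₁ hhst hcJ (a := 4 * κ) (b := bx) (by positivity) hbx hℓ hr heA heD
    hM hpos hH hHst hdV0 hdV hρ hsmall hA hJ ?_ ?_ hc3 hc3' hc3'' ?_ hAn
  · -- (c1) at the solution scale, from (ℓ1), (ℓ2) and the coordinates
    intro i ε Vk B hε hεD hreg hBg hBK
    rw [hdom i]
    have hsupp : IsSupportedOn (bondsOf (pts (I i).k (I i).Λ)) (ιA i B) :=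
      IsSupportedOn.mono (fun _ hb => hb.1) (hι1 i B hBg)
    refine orbit_expMul_subset ch hsupp (hext0 i Vk) (t := κ * ‖B‖)
      (fun b => (hexp _).trans (mul_le_mul_of_nonneg_left (hι3 i B b) hκ)) fun p hp => ?_
    have h1 := hextZ i ε Vk hε hεD hreg p hp
    have h2 := he1 i ε hε hεD
    have h3 : 4 * (κ * ‖B‖) ≤ 4 * κ * (2 * (I i).M ^ 5 * hst * cJ / γ) * ε := by
      have := mul_le_mul_of_nonneg_left hBK hκ
      nlinarith
    nlinarith
  · -- (c2) from the representative, the chart letters and the coordinates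
    intro i ε Vk V hε hεD hreg hV
    obtain ⟨u, hu, hagree, hsmall'⟩ := hrep i ε Vk V hε hεD hreg hV
    obtain ⟨A, hAsupp, hAval, -, hAeq⟩ := exists_vecField_expMul_eq ch (hδc i) (hlog i) hagree hsmall'
    have hAb : ∀ b, ‖A b‖ ≤ Cℓ * δc i := by
      intro b
      rcases hAval b with h | h
      · rw [h, norm_zero]; exact mul_nonneg hCℓ (hδc i).le
      · by_cases hcase : b ∈ T i ∨ b ∉ bondsOf (pts (I i).k (I i).Λ)
        · rw [h, hagree b hcase, mul_inv_cancel, ch.ilog_one, norm_zero]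
          exact mul_nonneg hCℓ (hδc i).le
        · have hd : dist1 (gaugeAct u V b * (ext i Vk b)⁻¹) < δc i := by
            push Not at hcase
            exact hsmall' b hcase.2 hcase.1
          rw [h]
          exact (hlip i _ hd).trans (mul_le_mul_of_nonneg_left hd.le hCℓ)
    obtain ⟨B, hBg, hBι, hBn⟩ := hι2 i A (Cℓ * δc i) hAsupp hAb
    refine ⟨B, hBg, hBn.trans (hN i), ?_⟩
    show V ∈ orbit (pts (I i).k (I i).Λ) (expMul ch (ιA i B) (ext i Vk))
    rw [hBι, hAeq]
    exact mem_orbit_comm.1 (gaugeAct_mem_orbit hu V)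
  · -- (c4) from (ℓ1), (ℓ2)
    intro i ε Vk B hε hreg hBg hBr p hp
    have h := B15Prop1ChartDeviation.dist1_plaqHol_expMul_le_of_forall ch (ιA i B) (ext i Vk) p
      (fun b => (hexp _).trans (mul_le_mul_of_nonneg_left (hι3 i B b) hκ))
    have h' := hextΛ i ε Vk hε hreg p hp
    show dist1 (plaqHol (expMul ch (ιA i B) (ext i Vk)) p) ≤ 4 * κ * ‖B‖ + bx * (I i).M ^ 2 * ε
    linarith

end Assembly

end Literature.MathematicalPhysics.QuantumFieldTheory.Balaban1983to89.B15Prop1CarrierOnFromLetters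

end
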